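import Literature.Geometry.Kaehler.ComplexTorusPoincareTransposeAndreDagger
import Literature.AlgebraicGeometry.Andre1996.PositiveInvolutionSemisimple
import HarnessLib

/-!
# André's Prop. 3.3 / Remarque 1 for the real Hodge structure `H•(X; ℝ)` of a polarised complex torus: the `ℝ`-algebra
# `End_{ℝ-HS}(H•(X; ℝ))` of real operators commuting with the Weil operator carries the POSITIVE involution `u ↦ u† = *_H ᵗu *_H`,
# hence it — and every `†`-stable subalgebra of it — has no nil right ideals, every element has a quasi-inverse, and it is SEMISIMPLE

Layer `Literature/Geometry/Kaehler`, namespace `Literature.Geometry.Kaehler.ComplexTorus`; lane `lit-hodgefound` (Track 2 foundations library),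
prover seat `lit-hodgefound-p35` (generation 52, row g52-#5; sequel of rows g52-#2 `ComplexTorusAndreTransposePositivity` (`Tr(u u†) > 0`), g52-#3
`ComplexTorusAndreAdjointInvolution` and g52-#4 `ComplexTorusPoincareTransposeAndreDagger` (`poincareTranspose`, `andreDagger`)). THREE DEFINITIONS WITH BODIES
(`hodgeRealEnd`, the `@[reducible]` structure-valued `andreDaggerStarRing` used only through `letI` — the pattern of
`ComplexTorusEndomorphismAlgebraSemisimple.rosatiStarRing` —, `hodgeRealEndTrace`) + theorems; no named fact, no instance, no notation; D-0026 net debt `0`.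
The abstract algebra (André's Remarque 1 / Herstein §1.4: a definite cyclic trace and an anti-involution kill nil right ideals and give quasi-inverses) is
REUSED from `Literature/AlgebraicGeometry/Andre1996/PositiveInvolutionSemisimple.lean`, not re-proved.

RELATION TO THE TREE (no duplicate). `ComplexTorusHodgeEndomorphismAlgebraSemisimple` proves `End_Hdg(Hˢ(X, ℚ))` semisimple for each degree `s` through
Jannsen's theorem on `B^g(X × X)` (`ComplexTorusCorrespondenceAlgebraSemisimple`: NON-DEGENERACY of the trace form `Tr(u ∘ ᵗv)`, no positivity) and the corner
isomorphism; `ComplexTorusEndomorphismAlgebraSemisimple` proves `End_ℚ(X)` (degree `1`) semisimple through the Rosati involution. THIS FILE is André's OWN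
mechanism of Prop. 3.3 — POSITIVITY of `(u, v) ↦ Tr(u v†)` for the involution `† = *_H ᵗ(·) *_H` — for the `ℝ`-algebra of ALL-DEGREE real Hodge
endomorphisms of `H•(X; ℝ) = ⊕ₖ Hᵏ(X; ℝ)` (the operators on `GForm E ℂ` commuting with complex conjugation and with the Weil operator `C = (e^{iπ/2})^*`,
i.e. the endomorphisms of the real Hodge structure `⊕ₖ Hᵏ`), and for its `†`-stable (non-unital) subalgebras «S ⊂ End M stable par ′» — the form in which
André applies it to motivated / algebraic correspondences.

## What is defined / proved (`C = rotG E (π/2)`, `u† = andreDagger Φ hη e u = *_H ᵗu *_H`)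

* §1 **def `hodgeRealEnd E`** — the `ℝ`-subalgebra of `Module.End ℂ (GForm E ℂ)` of REAL operators COMMUTING WITH `C`; `mem_hodgeRealEnd_iff`; members: `rotG_mem_hodgeRealEnd`
  (`(e^{iθ})^*`), `lefschetzG_mem_hodgeRealEnd` (`L_{η'}`, `η'` of type `(1,1)`), `lefschetzDualG_mem_hodgeRealEnd` (`Λ_η`), `weylOperator_mem_hodgeRealEnd` (`w`),
  `andreHodgeInvolution_mem_hodgeRealEnd` (`*_H`, `d = g`), **`poincareTranspose_mem_hodgeRealEnd`** (`ᵗu`), **`andreDagger_mem_hodgeRealEnd`** (`u†`: "stable par ′");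
  `finiteDimensional_hodgeRealEnd`, `isArtinianRing_hodgeRealEnd`.
* §2 **`@[reducible] def andreDaggerStarRing Φ h11 hη e : StarRing (hodgeRealEnd E)`** (`star u = u†`; `u†† = u`, `(uv)† = v†u†`, `(u+v)† = u† + v†`), `coe_andreDaggerStar`;
  **def `hodgeRealEndTrace E : hodgeRealEnd E →+ ℝ`** (`u ↦ Re Tr u`), `hodgeRealEndTrace_apply`, `hodgeRealEndTrace_mul_comm` (cyclic),
  **`re_trace_mul_andreDagger_eq_zero_iff`** / `hodgeRealEndTrace_mul_star_self_eq_zero` (DEFINITE: `Re Tr(u u†) = 0 ↔ u = 0`, Kähler datum).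
* §3 **`eq_zero_of_isNilpotent_mul_andreDagger`** (`u ∈ hodgeRealEnd`, `u u†` nilpotent ⟹ `u = 0`); **`eq_zero_of_mem_nil_rightIdeal_of_andreDagger_mem`** — Remarque 1 VERBATIM:
  for `S ⊆ hodgeRealEnd E` stable under `†` and `N ⊆ S` with `N·S ⊆ N` consisting of nilpotents, `N = 0`; **`exists_mul_mul_eq_self_of_andreDagger_mem`** — the OPERATIVE
  FORM: every `u` in a `†`-stable non-unital `ℝ`-subalgebra `S ⊆ hodgeRealEnd E` has a quasi-inverse `v ∈ S`, `u v u = u`; **`jacobson_hodgeRealEnd_eq_bot`**;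
  **`isSemisimpleRing_hodgeRealEnd`** ("semi-simple de dimension finie"); `IsRiemannForm.isSemisimpleRing_hodgeRealEnd`.

## Sources, VERBATIM

* Y. André, *Pour une théorie inconditionnelle des motifs*, Publ. Math. IHÉS **83** (1996) [Andre1996Motifs], held `paper:doi-10-1007-bf02698643`: Prop. 3.3 (p. 21 =
  chunk p0018 L33–L38) "La `ℚ`-algèbre `C⁰_mot(X, X)` est semi-simple de dimension finie. De plus, la forme bilinéaire symétrique sur `C⁰_mot(X, X)` donnée par
  `(u, v) ↦ Tr_{H(X)}(u *_H ᵗv *_H)` est à valeurs dans `ℚ`, et définie positive"; proof (p. 22 = chunk p0019 L1–L6) "… cf. [Kl68], 3.11"; Appendice Remarque 1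
  (pp. 46–47 = chunk p0043 L29–L31, p0044 L5–L8) "si `S` est une sous-algèbre de `End M` (non nécessairement unitaire) stable par `′`, `S` est semi-simple. En effet,
  comme `End M` est de dimension finie sur `ℚ`, il suffit de faire voir que si `𝔑` est un idéal à droite nilpotent de `S`, alors `𝔑 = 0`. … Si `ene ∈ 𝔑`, alors
  `(ene)(ene)′ ∈ 𝔑` est nilpotent, par conséquent `Tr((ene)(ene)′) = 0`, et `ene = 0`."
* S. L. Kleiman, *Algebraic cycles and the Weil conjectures* (1968) [Kleiman1968AlgebraicCycles], §3 Thm. 3.11 (cited through André).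
* I. N. Herstein, *Noncommutative Rings* [Herstein1994], §1.4 (Rickart's argument), Thm. 1.3.1 ("If R is Artinian then J(R) is a nilpotent ideal"), Thm. 1.4.2.
* U. Jannsen, *Motives, numerical equivalence, and semi-simplicity*, Invent. Math. **107** (1992) [Jannsen1992] (the non-degenerate-trace route, for contrast; not used).
* P. Deligne, *Théorie de Hodge II* (1971) [DeligneHodgeII1971], §2.1 (real Hodge structures and the Weil operator `C`).
-/

noncomputable section

namespace Literature.Geometry.Kaehler

namespace ComplexTorus

open Module Function Finset
open Literature.LinearAlgebra.Alternating Literature.Algebra.Lie Literature.Analysis.Complex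

set_option maxSynthPendingDepth 3
-- Type-class problems over the subtype ring `↥(hodgeRealEnd E)` (ideals, `star`, Artinian instances) explore commutative-ring branches that fail only
-- after unfolding the `Pi`/`ContinuousAlternatingMap` structure of `GForm E ℂ`; the default `synthInstance` budget (20000) is too small for them.
set_option synthInstance.maxHeartbeats 400000

universe uE

variable {ι : Type*} [Fintype ι] [DecidableEq ι] {E : Type uE} [NormedAddCommGroup E] [NormedSpace ℂ E] [FiniteDimensional ℂ E]
  (Φ : (ι → ℝ) ≃L[ℝ] E) {η : E [⋀^Fin 2]→L[ℝ] ℝ} {N : ℕ}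

/-! ## §1 The `ℝ`-algebra of real operators commuting with the Weil operator -/

section RealEnd

variable (E) in
/-- **`End_{ℝ-HS}(H•(X; ℝ))`, the `ℝ`-algebra of real Hodge endomorphisms of `H•(X; ℝ) = ⊕ₖ Hᵏ(X; ℝ)`**, realised inside `End_ℂ H•(X; ℂ)`: the operators commuting
with complex conjugation (REAL operators) and with the Weil operator `C = (e^{iπ/2})^*` (equivalently, preserving the Hodge decomposition of each `Hᵏ(X; ℂ)`). André's
`End M` for the real Hodge structure `M = ⊕ₖ Hᵏ(X)`. [cite: DeligneHodgeII1971, §2.1 (2.1.13–2.1.15)] [cite: Andre1996Motifs, Appendice Remarque 1 (p. 47)] -/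
def hodgeRealEnd : Subalgebra ℝ (Module.End ℂ (GForm E ℂ)) where
  carrier := {u | (∀ x, GForm.conjG (u x) = u (GForm.conjG x)) ∧ Commute (rotG E (Real.pi / 2)) u}
  mul_mem' {u v} hu hv := ⟨fun x ↦ by rw [Module.End.mul_apply, Module.End.mul_apply, hu.1, hv.1], hu.2.mul_right hv.2⟩
  one_mem' := ⟨fun _ ↦ rfl, Commute.one_right _⟩
  add_mem' {u v} hu hv := ⟨fun x ↦ by rw [LinearMap.add_apply, LinearMap.add_apply, GForm.conjG_add, hu.1, hv.1], hu.2.add_right hv.2⟩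
  zero_mem' := ⟨fun x ↦ by rw [LinearMap.zero_apply, LinearMap.zero_apply, GForm.conjG_zero], Commute.zero_right _⟩
  algebraMap_mem' r := ⟨fun x ↦ by rw [Module.algebraMap_end_apply, Module.algebraMap_end_apply, GForm.conjG_smul_real], Algebra.commute_algebraMap_right r _⟩

omit [FiniteDimensional ℂ E] in
/-- Membership: `u ∈ End_{ℝ-HS}` iff `u` is real and commutes with `C`. [cite: DeligneHodgeII1971, §2.1] -/
theorem mem_hodgeRealEnd_iff (u : Module.End ℂ (GForm E ℂ)) :
    u ∈ hodgeRealEnd E ↔ (∀ x, GForm.conjG (u x) = u (GForm.conjG x)) ∧ Commute (rotG E (Real.pi / 2)) u := Iff.rfl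

omit [FiniteDimensional ℂ E] in
/-- `(e^{iθ})^* ∈ End_{ℝ-HS}` (in particular the Weil operator `C`). [cite: DeligneHodgeII1971, §2.1 (2.1.14)] -/
theorem rotG_mem_hodgeRealEnd (θ : ℝ) : rotG E θ ∈ hodgeRealEnd E := ⟨conjG_rotG θ, commute_rotG _ _⟩

omit [FiniteDimensional ℂ E] in
/-- **`L_{η'} ∈ End_{ℝ-HS}`** for every real `2`-form `η'` of type `(1,1)` ("`[L, 𝐈] = 0`"). [cite: Andre1996Motifs, §1.1 (p. 10)] [cite: DeligneHodgeII1971, §2.1] -/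
theorem lefschetzG_mem_hodgeRealEnd {η' : E [⋀^Fin 2]→L[ℝ] ℝ} (h11' : ∀ u v : E, η' ![Complex.I • u, Complex.I • v] = η' ![u, v]) :
    (lefschetzG η' : Module.End ℂ (GForm E ℂ)) ∈ hodgeRealEnd E := by
  refine ⟨conjG_lefschetzG η', ?_⟩
  rw [rotG_eq_pullAlgHom]
  exact commute_pullAlgHom_lefschetzG (twoForm_rotateCLM h11' _)

variable [Nontrivial E] (hη : ∀ v : E, v ≠ 0 → ∃ w : E, η ![v, w] ≠ 0)

/-- **`Λ_η ∈ End_{ℝ-HS}`** (`η` of type `(1,1)`, non-degenerate; "`[Λ, 𝐈] = 0`"). [cite: Andre1996Motifs, §1.1 (p. 10)] -/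
theorem lefschetzDualG_mem_hodgeRealEnd (h11 : ∀ u v : E, η ![Complex.I • u, Complex.I • v] = η ![u, v]) (hη : ∀ v : E, v ≠ 0 → ∃ w : E, η ![v, w] ≠ 0) :
    (lefschetzDualG η : Module.End ℂ (GForm E ℂ)) ∈ hodgeRealEnd E := by
  refine ⟨conjG_lefschetzDualG hη, ?_⟩
  rw [rotG_eq_pullAlgHom]
  exact commute_pullAlgHom_lefschetzDualG hη (twoForm_rotateCLM h11 _)

/-- **The Weyl operator `w ∈ End_{ℝ-HS}`.** [cite: Andre1996Motifs, §1.2 (p. 11)] -/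
theorem weylOperator_mem_hodgeRealEnd (h11 : ∀ u v : E, η ![Complex.I • u, Complex.I • v] = η ![u, v]) (hη : ∀ v : E, v ≠ 0 → ∃ w : E, η ![v, w] ≠ 0) :
    (hasLefschetzProperty_lefschetzG hη).weylOperator isZGrading_countingG ∈ hodgeRealEnd E :=
  ⟨conjG_weylOperator hη, commute_rotG_weylOperator h11 hη _⟩

/-- **André's `*_H ∈ End_{ℝ-HS}`.** [cite: Andre1996Motifs, §1.1 (p. 10)] -/
theorem andreHodgeInvolution_mem_hodgeRealEnd (h11 : ∀ u v : E, η ![Complex.I • u, Complex.I • v] = η ![u, v]) (hη : ∀ v : E, v ≠ 0 → ∃ w : E, η ![v, w] ≠ 0) :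
    (hasLefschetzProperty_lefschetzG hη).andreHodgeInvolution isZGrading_countingG (finrank ℂ E) ∈ hodgeRealEnd E :=
  ⟨conjG_andreHodgeInvolution hη, commute_rotG_andreHodgeInvolution h11 hη _ (finrank ℂ E)⟩

omit [Nontrivial E] in
/-- **`ᵗu ∈ End_{ℝ-HS}` for `u ∈ End_{ℝ-HS}`** ("stable par transposition"). [cite: Andre1996Motifs, Prop. 2.3 (p. 16)] -/
theorem poincareTranspose_mem_hodgeRealEnd (e : Fin N ≃ ι) {u : Module.End ℂ (GForm E ℂ)} (hu : u ∈ hodgeRealEnd E) : poincareTranspose Φ e u ∈ hodgeRealEnd E :=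
  ⟨conjG_poincareTranspose_apply Φ e hu.1, commute_rotG_pi_div_two_poincareTranspose Φ e hu.2⟩

/-- **`u† ∈ End_{ℝ-HS}` for `u ∈ End_{ℝ-HS}`** («stable par ′»; `η` of type `(1,1)`). [cite: Andre1996Motifs, Prop. 3.3 (p. 21), Appendice Remarque 1 (p. 47)] -/
theorem andreDagger_mem_hodgeRealEnd (h11 : ∀ u v : E, η ![Complex.I • u, Complex.I • v] = η ![u, v]) (hη : ∀ v : E, v ≠ 0 → ∃ w : E, η ![v, w] ≠ 0) (e : Fin N ≃ ι)
    {u : Module.End ℂ (GForm E ℂ)} (hu : u ∈ hodgeRealEnd E) : andreDagger Φ hη e u ∈ hodgeRealEnd E :=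
  ⟨conjG_andreDagger_apply Φ hη e hu.1, commute_rotG_pi_div_two_andreDagger Φ h11 hη e hu.2⟩

omit [Nontrivial E] in
/-- `End_{ℝ-HS}` is finite-dimensional over `ℝ` ("de dimension finie"). [cite: Andre1996Motifs, Prop. 3.3 (p. 21)] -/
theorem finiteDimensional_hodgeRealEnd : FiniteDimensional ℝ (hodgeRealEnd E) := by
  haveI : FiniteDimensional ℝ (Module.End ℂ (GForm E ℂ)) := Module.Finite.trans ℂ (Module.End ℂ (GForm E ℂ))
  exact FiniteDimensional.finiteDimensional_subalgebra (hodgeRealEnd E)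

omit [Nontrivial E] in
/-- `End_{ℝ-HS}` is (left) Artinian. [cite: Herstein1994, Thm. 1.3.1] -/
theorem isArtinianRing_hodgeRealEnd : IsArtinianRing (hodgeRealEnd E) :=
  haveI := finiteDimensional_hodgeRealEnd (E := E)
  IsArtinianRing.of_finite ℝ (hodgeRealEnd E)

end RealEnd

/-! ## §2 The involution `†` as a `StarRing` structure and the trace `Re Tr` -/

section Star

variable [Nontrivial E]

/-- **André's involution `u ↦ u† = *_H ᵗu *_H` as a star structure on `End_{ℝ-HS}`** (`u†† = u`, `(uv)† = v†u†`, `(u + v)† = u† + v†`; it preserves `End_{ℝ-HS}` by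
`andreDagger_mem_hodgeRealEnd`): "on peut faire agir l'involution `′` sur `End M`". A `def` producing structure, used through `letI` in this file's proofs (not an
instance: it depends on `η` and `e`). [cite: Andre1996Motifs, Appendice Remarque 1 (p. 47), Prop. 3.3 (p. 21)] -/
@[reducible] def andreDaggerStarRing (h11 : ∀ u v : E, η ![Complex.I • u, Complex.I • v] = η ![u, v]) (hη : ∀ v : E, v ≠ 0 → ∃ w : E, η ![v, w] ≠ 0) (e : Fin N ≃ ι) :
    StarRing (hodgeRealEnd E) :=
  { star := fun u ↦ ⟨andreDagger Φ hη e u.1, andreDagger_mem_hodgeRealEnd Φ h11 hη e u.2⟩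
    star_involutive := fun u ↦ Subtype.ext (andreDagger_andreDagger Φ hη e u.2.2)
    star_mul := fun u v ↦ Subtype.ext (andreDagger_mul Φ hη e u.1 v.1)
    star_add := fun u v ↦ Subtype.ext (andreDagger_add Φ hη e u.1 v.1) }

/-- Unfolding: under `andreDaggerStarRing`, `↑(star u) = u†`. [cite: Andre1996Motifs, Appendice Remarque 1 (p. 47)] -/
theorem coe_andreDaggerStar (h11 : ∀ u v : E, η ![Complex.I • u, Complex.I • v] = η ![u, v]) (hη : ∀ v : E, v ≠ 0 → ∃ w : E, η ![v, w] ≠ 0) (e : Fin N ≃ ι)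
    (u : hodgeRealEnd E) : ((@star _ (andreDaggerStarRing Φ h11 hη e).toStar u : hodgeRealEnd E) : Module.End ℂ (GForm E ℂ)) = andreDagger Φ hη e u := rfl

omit [Nontrivial E] in
variable (E) in
/-- **The real trace `u ↦ Re Tr_{H•(X; ℂ)} u` on `End_{ℝ-HS}`** (André's `Tr`; the trace of a real operator is real, so nothing is lost). [cite: Andre1996Motifs, Prop. 3.3 (p. 21)] -/
def hodgeRealEndTrace : hodgeRealEnd E →+ ℝ :=
  Complex.reAddGroupHom.comp ((LinearMap.trace ℂ (GForm E ℂ)).toAddMonoidHom.comp (hodgeRealEnd E).val.toRingHom.toAddMonoidHom)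

omit [FiniteDimensional ℂ E] [Nontrivial E] in
/-- Unfolding: `hodgeRealEndTrace E u = Re Tr u`. [cite: Andre1996Motifs, Prop. 3.3 (p. 21)] -/
theorem hodgeRealEndTrace_apply (u : hodgeRealEnd E) : hodgeRealEndTrace E u = (LinearMap.trace ℂ (GForm E ℂ) (u : Module.End ℂ (GForm E ℂ))).re := rfl

omit [FiniteDimensional ℂ E] [Nontrivial E] in
/-- The real trace is CYCLIC: `Re Tr(uv) = Re Tr(vu)`. [cite: Andre1996Motifs, Prop. 3.3 (p. 21)] -/
theorem hodgeRealEndTrace_mul_comm (u v : hodgeRealEnd E) : hodgeRealEndTrace E (u * v) = hodgeRealEndTrace E (v * u) := by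
  rw [hodgeRealEndTrace_apply, hodgeRealEndTrace_apply, Subalgebra.coe_mul, Subalgebra.coe_mul, LinearMap.trace_mul_comm]

/-- **DEFINITENESS: `Re Tr(u u†) = 0 ↔ u = 0` on `End_{ℝ-HS}`** (`η` a Kähler datum, `e : Fin (2g) ≃ ι`) — from `Tr(u u†) = c > 0` for `u ≠ 0` (row g52-#2).
[cite: Andre1996Motifs, Prop. 3.3 (p. 21)] [cite: Kleiman1968AlgebraicCycles, §3 Thm. 3.11] -/
theorem re_trace_mul_andreDagger_eq_zero_iff (h11 : ∀ u v : E, η ![Complex.I • u, Complex.I • v] = η ![u, v])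
    (hpos : ∀ u : E, u ≠ 0 → 0 < η ![Complex.I • u, u]) (hη : ∀ v : E, v ≠ 0 → ∃ w : E, η ![v, w] ≠ 0) {g : ℕ} (e : Fin (2 * g) ≃ ι) {u : Module.End ℂ (GForm E ℂ)}
    (hu : u ∈ hodgeRealEnd E) : (LinearMap.trace ℂ (GForm E ℂ) (u * andreDagger Φ hη e u)).re = 0 ↔ u = 0 := by
  refine ⟨fun h ↦ ?_, fun h ↦ by rw [h, zero_mul, map_zero, Complex.zero_re]⟩
  by_contra h0
  obtain ⟨c, hc, hcu⟩ := exists_pos_trace_mul_andreDagger Φ h11 hpos hη e hu.2 hu.1 h0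
  rw [hcu, Complex.ofReal_re] at h
  exact hc.ne' h

/-- The same for the `StarRing` structure: `hodgeRealEndTrace E (u ⋆ u†) = 0 ⟹ u = 0` — the DEFINITENESS hypothesis of `Andre1996.PositiveInvolutionSemisimple`.
[cite: Andre1996Motifs, Prop. 3.3 (p. 21), Appendice Remarque 1 (p. 46: "définie positive")] -/
theorem hodgeRealEndTrace_mul_star_self_eq_zero (h11 : ∀ u v : E, η ![Complex.I • u, Complex.I • v] = η ![u, v])
    (hpos : ∀ u : E, u ≠ 0 → 0 < η ![Complex.I • u, u]) (hη : ∀ v : E, v ≠ 0 → ∃ w : E, η ![v, w] ≠ 0) {g : ℕ} (e : Fin (2 * g) ≃ ι) (u : hodgeRealEnd E)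
    (h : hodgeRealEndTrace E (u * @star _ (andreDaggerStarRing Φ h11 hη e).toStar u) = 0) : u = 0 :=
  Subtype.ext ((re_trace_mul_andreDagger_eq_zero_iff Φ h11 hpos hη e u.2).1 h)

end Star

/-! ## §3 André's Prop. 3.3 / Remarque 1: no nil right ideals, quasi-inverses, semisimplicity -/

section Semisimple

variable [Nontrivial E] (h11 : ∀ u v : E, η ![Complex.I • u, Complex.I • v] = η ![u, v]) (hpos : ∀ u : E, u ≠ 0 → 0 < η ![Complex.I • u, u])
  (hη : ∀ v : E, v ≠ 0 → ∃ w : E, η ![v, w] ≠ 0) {g : ℕ} (e : Fin (2 * g) ≃ ι)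

include h11 hpos in
/-- **No non-zero `u ∈ End_{ℝ-HS}` has `u u†` nilpotent** («`(ene)(ene)′` … est nilpotent, par conséquent `Tr((ene)(ene)′) = 0`, et `ene = 0`»): André's Remarque 1 step,
fed with the positivity `Tr(u u†) > 0` — the abstract `Andre1996.eq_zero_of_isNilpotent_mul_star` for the definite cyclic trace `Re Tr` and the star `†`.
[cite: Andre1996Motifs, Appendice Remarque 1 (p. 47), Prop. 3.3 (p. 21)] [cite: Herstein1994, §1.4] -/
theorem eq_zero_of_isNilpotent_mul_andreDagger {u : Module.End ℂ (GForm E ℂ)} (hu : u ∈ hodgeRealEnd E) (hnil : IsNilpotent (u * andreDagger Φ hη e u)) : u = 0 := by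
  letI : StarRing (hodgeRealEnd E) := andreDaggerStarRing Φ h11 hη e
  have hcyc : ∀ x y : hodgeRealEnd E, hodgeRealEndTrace E (x * y) = hodgeRealEndTrace E (y * x) := hodgeRealEndTrace_mul_comm
  have hdef : ∀ x : hodgeRealEnd E, hodgeRealEndTrace E (x * star x) = 0 → x = 0 := fun x hx ↦
    hodgeRealEndTrace_mul_star_self_eq_zero Φ h11 hpos hη e x hx
  have hx : (⟨u, hu⟩ : hodgeRealEnd E) = 0 := by
    refine Literature.AlgebraicGeometry.Andre1996.eq_zero_of_isNilpotent_mul_star (hodgeRealEndTrace E) hcyc hdef ?_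
    obtain ⟨n, hn⟩ := hnil
    refine ⟨n, Subtype.ext ?_⟩
    rw [Subalgebra.coe_pow, Subalgebra.coe_mul, coe_andreDaggerStar, hn, Subalgebra.coe_zero]
  exact congrArg Subtype.val hx

include h11 hpos in
/-- **André 1996, Appendice Remarque 1, VERBATIM for `End M = End_{ℝ-HS}(H•(X; ℝ))`**: «si `S` est une sous-algèbre de `End M` (non nécessairement unitaire) stable par `′` …
si `𝔑` est un idéal à droite nilpotent de `S`, alors `𝔑 = 0`» — for any subset `S ⊆ End_{ℝ-HS}` stable under `†` and any `N ⊆ S` with `N · S ⊆ N` consisting of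
nilpotent operators (nil suffices), every `x ∈ N` is `0` (because `x x† ∈ N`). [cite: Andre1996Motifs, Appendice Remarque 1 (p. 47)] -/
theorem eq_zero_of_mem_nil_rightIdeal_of_andreDagger_mem {S N : Set (Module.End ℂ (GForm E ℂ))} (hS : S ⊆ hodgeRealEnd E)
    (hSdag : ∀ u ∈ S, andreDagger Φ hη e u ∈ S) (hNS : N ⊆ S) (hN : ∀ n ∈ N, ∀ s ∈ S, n * s ∈ N) (hnil : ∀ n ∈ N, IsNilpotent n)
    {x : Module.End ℂ (GForm E ℂ)} (hx : x ∈ N) : x = 0 :=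
  eq_zero_of_isNilpotent_mul_andreDagger Φ h11 hpos hη e (hS (hNS hx)) (hnil _ (hN x hx _ (hSdag x (hNS hx))))

include Φ h11 hpos hη e in
/-- **`End_{ℝ-HS}` itself has no non-zero nil right ideal.** [cite: Andre1996Motifs, Appendice Remarque 1 (p. 47)] -/
theorem eq_zero_of_mem_nil_rightIdeal_hodgeRealEnd {N : Set (hodgeRealEnd E)} (hN : ∀ n ∈ N, ∀ s : hodgeRealEnd E, n * s ∈ N) (hnil : ∀ n ∈ N, IsNilpotent n)
    {x : hodgeRealEnd E} (hx : x ∈ N) : x = 0 := by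
  have hxs : x * ⟨andreDagger Φ hη e x, andreDagger_mem_hodgeRealEnd Φ h11 hη e x.2⟩ ∈ N := hN x hx _
  obtain ⟨n, hn⟩ := hnil _ hxs
  refine Subtype.ext (eq_zero_of_isNilpotent_mul_andreDagger Φ h11 hpos hη e x.2 ⟨n, ?_⟩)
  have h := congrArg Subtype.val hn
  rw [Subalgebra.coe_pow, Subalgebra.coe_mul] at h
  exact h

include h11 hpos in
/-- **THE OPERATIVE FORM (André's use of Prop. 3.3 / Remarque 1): every `u` in a `†`-stable non-unital `ℝ`-subalgebra `S ⊆ End_{ℝ-HS}` has a QUASI-INVERSE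
`v ∈ S`, `u v u = u`** — the abstract `Andre1996.exists_mul_mul_eq_self_of_mem` (Herstein Thm. 1.4.2) for the definite cyclic trace `Re Tr` and the star `†`.
[cite: Andre1996Motifs, Appendice Remarque 1 (p. 47) and Prop. 3.3 (pp. 21–22)] [cite: Herstein1994, Thm. 1.4.2 and Cor. 2] -/
theorem exists_mul_mul_eq_self_of_andreDagger_mem (S : NonUnitalSubalgebra ℝ (Module.End ℂ (GForm E ℂ))) (hS : ∀ u ∈ S, u ∈ hodgeRealEnd E)
    (hSdag : ∀ u ∈ S, andreDagger Φ hη e u ∈ S) {u : Module.End ℂ (GForm E ℂ)} (hu : u ∈ S) : ∃ v ∈ S, u * v * u = u := by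
  letI : StarRing (hodgeRealEnd E) := andreDaggerStarRing Φ h11 hη e
  haveI := finiteDimensional_hodgeRealEnd (E := E)
  have hcyc : ∀ x y : hodgeRealEnd E, hodgeRealEndTrace E (x * y) = hodgeRealEndTrace E (y * x) := hodgeRealEndTrace_mul_comm
  have hdef : ∀ x : hodgeRealEnd E, hodgeRealEndTrace E (x * star x) = 0 → x = 0 := fun x hx ↦
    hodgeRealEndTrace_mul_star_self_eq_zero Φ h11 hpos hη e x hx
  let S' : NonUnitalStarSubalgebra ℝ (hodgeRealEnd E) :=
    { carrier := {x | (x : Module.End ℂ (GForm E ℂ)) ∈ S}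
      add_mem' := fun {a b} ha hb ↦ S.add_mem ha hb
      zero_mem' := S.zero_mem
      mul_mem' := fun {a b} ha hb ↦ S.mul_mem ha hb
      smul_mem' := fun c {a} ha ↦ S.smul_mem c ha
      star_mem' := fun {a} ha ↦ hSdag _ ha }
  obtain ⟨v, hv, huv⟩ := Literature.AlgebraicGeometry.Andre1996.exists_mul_mul_eq_self_of_mem (hodgeRealEndTrace E) hcyc hdef S'
    (u := ⟨u, hS u hu⟩) hu
  refine ⟨v, hv, ?_⟩
  have h := congrArg Subtype.val huv
  rw [Subalgebra.coe_mul, Subalgebra.coe_mul] at h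
  exact h

include Φ h11 hpos hη e in
/-- **The Jacobson radical of `End_{ℝ-HS}(H•(X; ℝ))` is zero** for a polarised complex torus: the radical of the Artinian ring `End_{ℝ-HS}` is nilpotent (Herstein Thm. 1.3.1,
Mathlib `IsArtinianRing.isNilpotent_jacobson_bot`), hence a nil two-sided ideal, hence zero. [cite: Andre1996Motifs, Prop. 3.3 (p. 21), Appendice Remarque 1 (p. 47)]
[cite: Herstein1994, Thm. 1.3.1] -/
theorem jacobson_hodgeRealEnd_eq_bot : Ring.jacobson (hodgeRealEnd E) = ⊥ := by
  haveI := isArtinianRing_hodgeRealEnd (E := E)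
  have hJ : IsNilpotent (Ideal.jacobson (⊥ : Ideal (hodgeRealEnd E))) := IsArtinianRing.isNilpotent_jacobson_bot
  rw [Ideal.jacobson_bot] at hJ
  obtain ⟨n, hn⟩ := hJ
  refine (Submodule.eq_bot_iff _).2 fun x hx ↦ ?_
  refine eq_zero_of_mem_nil_rightIdeal_hodgeRealEnd Φ h11 hpos hη e (N := (Ring.jacobson (hodgeRealEnd E) : Set _))
    (fun a ha s ↦ Ideal.mul_mem_right s _ ha) (fun a ha ↦ ⟨n, ?_⟩) hx
  have h := Ideal.pow_mem_pow ha n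
  rw [hn] at h
  exact (Submodule.mem_bot _).1 h

include Φ h11 hpos hη e in
/-- **André 1996, Prop. 3.3 (first clause) / Remarque 1 for the real Hodge structure of a polarised complex torus: the `ℝ`-algebra `End_{ℝ-HS}(H•(X; ℝ))` of real
operators commuting with the Weil operator is SEMISIMPLE** ("semi-simple de dimension finie") — by the positivity of the involution `†` (Hodge index on the torus,
rows g52-#1/#2), not by Jannsen's non-degeneracy argument. Hypotheses: `η` a Kähler datum (type `(1,1)`, `η(iu, u) > 0`), `e : Fin (2g) ≃ ι`.
[cite: Andre1996Motifs, Prop. 3.3 (p. 21), Appendice Remarque 1 (p. 47)] [cite: Kleiman1968AlgebraicCycles, §3 Thm. 3.11] -/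
theorem isSemisimpleRing_hodgeRealEnd : IsSemisimpleRing (hodgeRealEnd E) := by
  haveI := isArtinianRing_hodgeRealEnd (E := E)
  exact IsArtinianRing.isSemisimpleRing_iff_jacobson.2 (jacobson_hodgeRealEnd_eq_bot Φ h11 hpos hη e)

/-- **Semisimplicity of `End_{ℝ-HS}(H•(X; ℝ))` for a Riemann form.** [cite: Andre1996Motifs, Prop. 3.3 (p. 21)] -/
theorem IsRiemannForm.isSemisimpleRing_hodgeRealEnd (hR : IsRiemannForm Φ η) {g : ℕ} (e : Fin (2 * g) ≃ ι) : IsSemisimpleRing (hodgeRealEnd E) :=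
  ComplexTorus.isSemisimpleRing_hodgeRealEnd Φ hR.1 hR.2.2 (hR.exists_apply_ne_zero Φ) e

end Semisimple

end ComplexTorus

end Literature.Geometry.Kaehler
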